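import Summits.Langlands.Langlands.Theorems.SkinnerWilesDefectOneEisensteinProModularSeedRestrictTwistGaloisPackage

/-!
# Stub `stub_restrictTwistGaloisPackageNu` of the line `descend-raise-basechange`
# (crux `Summit.Langlands.Langlands.Theses.SkinnerWilesDefectOne.EisensteinProModularSeed`, stmt-Langlands-12920)

**S3, strengthened form (lead's reshape after wave 1).**  Same hypotheses and construction as the landed
`stub_restrictTwistGaloisPackage` (`ν :=` Teichmüller lift of `χ̄_a`, `r := ν ⊗ ρ'|_{Γ_F}`,
`r₀ := ν₀ · ρ'₀|_{Γ_F}`, `q := M𝓞_F`, `S := {v ∣ p} ∪ {q} ∪ {v : χ̄_a or χ̄_b ramified at v}`), with ONE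
extra conjunct in the conclusion, consumed by the neighbouring stub S4 (`stub_quadraticBaseChangeTwist`,
quadratic base change + twist): **`ν` is unramified outside `S`** — every inertia group above a place
`v ∉ S` is killed by `ν`.  This is immediate from the construction: at `v ∉ S` both residual characters are
unramified, in particular `(ρ₀ σ)₀₀ ≡ 1` on inertia, and `ν` is trivial wherever `χ̄_a` is
(`RestrictTwist.exists_teichmuller_character`).  The proof is the landed proof of
`stub_restrictTwistGaloisPackage` with that one extra branch; the statement is the registered stub
`stub_restrictTwistGaloisPackageNu` of the reshaped skeleton (readable form, same `open`s as the landed file).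

References: C. Skinner, A. Wiles, *Residually reducible representations and modular forms*, Publ. Math.
IHÉS 89 (1999), §1; J.-P. Serre, *Abelian ℓ-adic representations* (1968), Ch. I §2.1. [folklore]
-/

set_option linter.dupNamespace false -- project-wide option (lakefile weak.linter.dupNamespace); `Summit.Langlands.Langlands` is the mandated namespace

noncomputable section

namespace Summit.Langlands.Langlands.Theorems.SkinnerWilesDefectOne.EisensteinProModularSeed

open Literature.NumberTheory.GaloisRepresentations
open Summit.Langlands.Langlands.Theorems.EisensteinProModularSeed.Negative
  (mem_maximalIdeal_of_v_lt_one entry_eq_of_integralModel sub_mem_maximalIdeal_iff)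
open Summit.Langlands.Langlands.Theorems.SkinnerWilesDefectOne.EisensteinProModularSeed.RestrictTwist
open IsLocalRing Field IsDedekindDomain NumberField Filter
open scoped NumberField Matrix

/-- **stub_restrictTwistGaloisPackageNu** (line `descend-raise-basechange`, S3 strengthened): the Galois-side
transport of `stub_restrictTwistGaloisPackage` — restrict the `ℚ`-side package to `Γ_F`, twist by the
Teichmüller lift `ν` of `χ̄_a`, Clifford irreducibility, oriented frames at `v ∣ p`, level set `S` — with the
extra output "`ν` is unramified outside `S`" (`∀ v ∉ S, ∀ 𝔓 ∣ v, ∀ σ ∈ I_𝔓, ν σ = 1`).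
Skinner–Wiles (1999) §1; Serre (1968) Ch. I §2.1. [folklore] -/
theorem stub_restrictTwistGaloisPackageNu :
    ∀ (F : Type) [Field F] [NumberField F], IsTotallyComplex F → Module.finrank ℚ F = 2 → ∀ (p : ℕ) [Fact p.Prime] (O : ValuationSubring (PadicAlgCl p)), O = (Valued.v : Valuation (PadicAlgCl p) NNReal).valuationSubring → ∀ (ρ : FramedGaloisRep F (PadicAlgCl p) 2) (ρ₀ : absoluteGaloisGroup F →* Matrix.GeneralLinearGroup (Fin 2) O), (∀ᶠ v in cofinite, ρ.IsUnramifiedAt v) → ρ.HasUpperTriangularIntegralModel ρ₀ → (∀ v : HeightOneSpectrum (𝓞 F), (p : 𝓞 F) ∈ v.asIdeal → IsPDistinguishedAt ρ₀ v) → ∀ (η : absoluteGaloisGroup ℚ →ₜ* (PadicAlgCl p)ˣ) (M k : ℕ) (ρ' : FramedGaloisRep ℚ (PadicAlgCl p) 2) (ρ'₀ : absoluteGaloisGroup ℚ →* Matrix.GeneralLinearGroup (Fin 2) O), (∀ τ, Valued.v ((η τ : (PadicAlgCl p)ˣ) : PadicAlgCl p) = 1) → (∀ σ : absoluteGaloisGroup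 F, Valued.v (((η (absGaloisRestrict ℚ F σ) : (PadicAlgCl p)ˣ) : PadicAlgCl p) * ((ρ₀ σ).val 0 0 : PadicAlgCl p) - ((ρ₀ σ).val 1 1 : PadicAlgCl p)) < 1) → M.Prime → (Ideal.span {(M : 𝓞 F)}).IsPrime → 2 ≤ k → ρ'.toGaloisRep.IsIrreducible → ρ'.HasUpperTriangularIntegralModel ρ'₀ → (∀ g, ((ρ'₀ g).val 0 0 - 1 : O) ∈ maximalIdeal O ∧ Valued.v (((ρ'₀ g).val 1 1 : PadicAlgCl p) - ((η g : (PadicAlgCl p)ˣ) : PadicAlgCl p)) < 1) → (∀ w : HeightOneSpectrum (𝓞 ℚ), (p : 𝓞 ℚ) ∈ w.asIdeal → ∃ Q : Matrix.GeneralLinearGroup (Fin 2) (PadicAlgCl p), Valued.v (Q.val 0 0) ≤ Valued.v (Q.val 1 0) ∧ ∀ σ, (Q⁻¹ * ρ'.toLocal w σ * Q).val 1 0 = 0 ∧ (σ ∈ absInertia (w.adicCompletion ℚ) → (Q⁻¹ * ρ'.toLocal w σ * Q).val 1 1 = 1 ∧ (Q⁻¹ * ρ'.toLocal w σ * Q).val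 0 0 = algebraMap (Padic p) (PadicAlgCl p) (((GaloisRep.cyclotomicCharacter (w.adicCompletion ℚ) p σ).val : PadicInt p) : Padic p) ^ (k - 1))) → (∀ w : HeightOneSpectrum (𝓞 ℚ), (M : 𝓞 ℚ) ∉ w.asIdeal → (p : 𝓞 ℚ) ∉ w.asIdeal → ∀ 𝔓 ∈ w.primesAbove, ∀ σ ∈ 𝔓.inertia (absoluteGaloisGroup ℚ), Valued.v (((η σ : (PadicAlgCl p)ˣ) : PadicAlgCl p) - 1) < 1 → ρ' σ = 1) → ∃ (r : FramedGaloisRep F (PadicAlgCl p) 2) (r₀ : absoluteGaloisGroup F →* Matrix.GeneralLinearGroup (Fin 2) O) (ν : absoluteGaloisGroup F →ₜ* (PadicAlgCl p)ˣ) (q : HeightOneSpectrum (𝓞 F)) (S : Set (HeightOneSpectrum (𝓞 F))), (∃ n : ℕ, 0 < n ∧ ∀ σ, ν σ ^ n = 1) ∧ (∀ σ, (r σ).val = ((ν σ : (PadicAlgCl p)ˣ) : PadicAlgCl p) • (ρ' (absGaloisRestrict ℚ F σ)).val) ∧ r.toGaloisRep.IsIrreducible ∧ r.HasUpperTriangularIntegralModel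 r₀ ∧ (∀ g, ((r₀ g).val 0 0 - (ρ₀ g).val 0 0 : O) ∈ maximalIdeal O ∧ ((r₀ g).val 1 1 - (ρ₀ g).val 1 1 : O) ∈ maximalIdeal O) ∧ (∃ k' : ℕ, 2 ≤ k' ∧ ∃ m : ℕ, 0 < m ∧ ∀ v : HeightOneSpectrum (𝓞 F), (p : 𝓞 F) ∈ v.asIdeal → ∃ Q : Matrix.GeneralLinearGroup (Fin 2) (PadicAlgCl p), Valued.v (Q.val 0 0) ≤ Valued.v (Q.val 1 0) ∧ ∀ σ, (Q⁻¹ * r.toLocal v σ * Q).val 1 0 = 0 ∧ (σ ∈ absInertia (v.adicCompletion F) → (Q⁻¹ * r.toLocal v σ * Q).val 1 1 ^ m = 1 ∧ (Q⁻¹ * r.toLocal v σ * Q).val 0 0 ^ m = algebraMap (Padic p) (PadicAlgCl p) (((GaloisRep.cyclotomicCharacter (v.adicCompletion F) p σ).val : PadicInt p) : Padic p) ^ ((k' - 1) * m))) ∧ S.Finite ∧ (∀ v : HeightOneSpectrum (𝓞 F), (p : 𝓞 F) ∈ v.asIdeal → v ∈ S) ∧ (∀ v ∉ S, r.IsUnramifiedAt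 v) ∧ (∀ v ∉ S, ∀ 𝔓 ∈ v.primesAbove, ∀ σ ∈ 𝔓.inertia (absoluteGaloisGroup F), ν σ = 1) ∧ (∀ v : HeightOneSpectrum (𝓞 F), v ≠ q → (p : 𝓞 F) ∉ v.asIdeal → (∀ 𝔓 ∈ v.primesAbove, ∀ σ ∈ 𝔓.inertia (absoluteGaloisGroup F), ((ρ₀ σ).val 0 0 - 1 : O) ∈ maximalIdeal O ∧ ((ρ₀ σ).val 1 1 - 1 : O) ∈ maximalIdeal O) → v ∉ S) := by
  intro F _ _ _ hF2 p _ O hO ρ ρ₀ hunr hmod hdist η M k ρ' ρ'₀ hη hdesc hM hMF hk hirr hmod' hdiag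
    hord hlev
  classical
  -- the Teichmüller character `ν` and the twist `r = ν ⊗ ρ'|_{Γ_F}` with its integral model `r₀`
  obtain ⟨ν₀, ν, n, hn, hν₀n, hνν₀, hν₀res, hν₀1⟩ := exists_teichmuller_character hO hmod
  obtain ⟨r₀, hr₀⟩ := exists_integral_twist (ρ'₀.comp (absGaloisRestrict ℚ F).toMonoidHom) ν₀
  set r : FramedGaloisRep F (PadicAlgCl p) 2 := FramedRep.twist (ρ'.restrictField F) ν with hr_def
  have hr : ∀ σ, r σ = FramedRep.scalar (PadicAlgCl p) 2 (ν σ) * ρ' (absGaloisRestrict ℚ F σ) :=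
    fun σ => rfl
  have hνn : ∀ σ, ν σ ^ n = 1 := fun σ => by rw [hνν₀, ← map_pow, hν₀n, map_one]
  have hν1 : ∀ σ, ((ρ₀ σ).val 0 0 - 1 : O) ∈ maximalIdeal O → ν σ = 1 := fun σ hσ => by
    rw [hνν₀, hν₀1 σ hσ, map_one]
  have hr₀' : ∀ g (i j : Fin 2), (r₀ g).val i j =
      (ν₀ g : O) * (ρ'₀ (absGaloisRestrict ℚ F g)).val i j := fun g i j => by
    rw [hr₀ g, scalar_mul_val_apply]; rfl
  -- `r₀` is a residually upper-triangular integral model of `r`, with the diagonal of `ρ₀`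
  have hmodr : r.HasUpperTriangularIntegralModel r₀ := by
    refine ⟨fun g => Units.ext (Matrix.ext fun i j => ?_),
      (isResiduallyUpperTriangular_two_iff r₀).mpr fun g => ?_⟩
    · change O.subtype ((r₀ g).val i j) = (r g).val i j
      rw [hr, hr₀', scalar_mul_val_apply, map_mul, hνν₀, Units.coe_map,
        entry_eq_of_integralModel hmod' _ i j]
      rfl
    · rw [hr₀']
      exact Ideal.mul_mem_left _ _ ((isResiduallyUpperTriangular_two_iff _).mp hmod'.2 _)
  have hdiagr : ∀ g, ((r₀ g).val 0 0 - (ρ₀ g).val 0 0 : O) ∈ maximalIdeal O ∧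
      ((r₀ g).val 1 1 - (ρ₀ g).val 1 1 : O) ∈ maximalIdeal O := by
    intro g
    obtain ⟨ha, hd⟩ := hdiag (absGaloisRestrict ℚ F g)
    have hηO : ((η (absGaloisRestrict ℚ F g) : (PadicAlgCl p)ˣ) : PadicAlgCl p) ∈ O := by
      rw [hO, Valuation.mem_valuationSubring_iff]; exact (hη _).le
    have hd' : (ρ'₀ (absGaloisRestrict ℚ F g)).val 1 1 - ⟨_, hηO⟩ ∈ maximalIdeal O :=
      mem_maximalIdeal_of_v_lt_one hO (by push_cast; exact hd)
    have hdesc' : (ρ₀ g).val 0 0 * ⟨_, hηO⟩ - (ρ₀ g).val 1 1 ∈ maximalIdeal O :=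
      mem_maximalIdeal_of_v_lt_one hO (by push_cast; rw [mul_comm]; exact hdesc g)
    rw [sub_mem_maximalIdeal_iff] at ha hd' hdesc'
    rw [sub_mem_maximalIdeal_iff, sub_mem_maximalIdeal_iff, hr₀', hr₀', map_mul, map_mul, hν₀res,
      ha, hd', map_one, mul_one, ← map_mul, hdesc']
    exact ⟨rfl, rfl⟩
  -- the auxiliary place `q = M𝓞_F` and the level set `S`
  have hM0 : Ideal.span {(M : 𝓞 F)} ≠ ⊥ := by
    rw [Ne, Ideal.span_singleton_eq_bot]; exact Nat.cast_ne_zero.mpr hM.ne_zero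
  set q : HeightOneSpectrum (𝓞 F) := ⟨Ideal.span {(M : 𝓞 F)}, hMF, hM0⟩ with hq
  set S : Set (HeightOneSpectrum (𝓞 F)) :=
    {v | (p : 𝓞 F) ∈ v.asIdeal} ∪ {q} ∪
      {v | ¬ ∀ 𝔓 ∈ v.primesAbove, ∀ σ ∈ 𝔓.inertia (absoluteGaloisGroup F),
        ((ρ₀ σ).val 0 0 - 1 : O) ∈ maximalIdeal O ∧ ((ρ₀ σ).val 1 1 - 1 : O) ∈ maximalIdeal O}
    with hS
  refine ⟨r, r₀, ν, q, S, ⟨n, hn, hνn⟩, fun σ => FramedRep.coe_twist_apply _ _ σ,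
    isIrreducible_twist_restrict hF2 hO hdist η hη hdesc hirr hmod' hdiag ν r hr, hmodr, hdiagr,
    ⟨k, hk, n, hn, fun v hv => orientedOrdinary_twist_restrict hO η hη hmod' hdiag hord ν hνn r hr v hv⟩,
    ?_, fun v hv => Set.mem_union_left _ (Set.mem_union_left _ hv), fun v hvS => ?_,
    fun v hvS 𝔓 h𝔓 σ hσ => ?_, fun v hvq hpv hres hvS => ?_⟩
  · -- `S` is finite: `{χ̄ ramified} ⊆ {ρ ramified}`
    have h1 : {v : HeightOneSpectrum (𝓞 F) | (p : 𝓞 F) ∈ v.asIdeal}.Finite := by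
      have hp0 : Ideal.span {(p : 𝓞 F)} ≠ 0 := by
        rw [Ne, Submodule.zero_eq_bot, Ideal.span_singleton_eq_bot]
        exact Nat.cast_ne_zero.mpr (Fact.out : p.Prime).ne_zero
      exact (Ideal.finite_factors hp0).subset fun v hv => Ideal.dvd_span_singleton.mpr hv
    have h3 : {v : HeightOneSpectrum (𝓞 F) | ¬ ∀ 𝔓 ∈ v.primesAbove,
        ∀ σ ∈ 𝔓.inertia (absoluteGaloisGroup F), ((ρ₀ σ).val 0 0 - 1 : O) ∈ maximalIdeal O ∧
          ((ρ₀ σ).val 1 1 - 1 : O) ∈ maximalIdeal O}.Finite := by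
      refine (Filter.eventually_cofinite.mp hunr).subset fun v hv hunrv => hv fun 𝔓 h𝔓 σ hσ => ?_
      have e : ∀ i, (ρ₀ σ).val i i = 1 := fun i => by
        apply Subtype.ext
        rw [← entry_eq_of_integralModel hmod σ i i, hunrv 𝔓 h𝔓 σ hσ]
        simp
      rw [e 0, e 1, sub_self]
      exact ⟨zero_mem _, zero_mem _⟩
    exact (h1.union (Set.finite_singleton q)).union h3
  · -- `r` is unramified outside `S`
    have hpv : (p : 𝓞 F) ∉ v.asIdeal := fun h => hvS (Set.mem_union_left _ (Set.mem_union_left _ h))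
    have hvq : v ≠ q := fun h => hvS (Set.mem_union_left _ (Set.mem_union_right _ h))
    have hres : ∀ 𝔓 ∈ v.primesAbove, ∀ σ ∈ 𝔓.inertia (absoluteGaloisGroup F),
        ((ρ₀ σ).val 0 0 - 1 : O) ∈ maximalIdeal O ∧ ((ρ₀ σ).val 1 1 - 1 : O) ∈ maximalIdeal O := by
      by_contra h
      exact hvS (Set.mem_union_right _ h)
    have hMv : (M : 𝓞 F) ∉ v.asIdeal := fun hMv => hvq (by
      have hle : Ideal.span {(M : 𝓞 F)} ≤ v.asIdeal := (Ideal.span_singleton_le_iff_mem _).mpr hMv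
      exact HeightOneSpectrum.ext ((hMF.isMaximal hM0).eq_of_le v.isPrime.ne_top hle).symm)
    exact isUnramifiedAt_twist_restrict hO η hη hdesc hlev ν hν1 r hr hpv hMv hres
  · -- `ν` is unramified outside `S`: `ν` is the Teichmüller lift of `χ̄_a`, trivial where `χ̄_a` is
    have hres : ∀ 𝔓 ∈ v.primesAbove, ∀ σ ∈ 𝔓.inertia (absoluteGaloisGroup F),
        ((ρ₀ σ).val 0 0 - 1 : O) ∈ maximalIdeal O ∧ ((ρ₀ σ).val 1 1 - 1 : O) ∈ maximalIdeal O := by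
      by_contra h
      exact hvS (Set.mem_union_right _ h)
    exact hν1 σ (hres 𝔓 h𝔓 σ hσ).1
  · -- the level clause
    rcases hvS with (hv | hv) | hv
    · exact hpv hv
    · exact hvq hv
    · exact hv hres

end Summit.Langlands.Langlands.Theorems.SkinnerWilesDefectOne.EisensteinProModularSeed

end
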